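import Literature.NumberTheory.ComplexMultiplication.CMTypeRankPartialConjugation
import HarnessLib

/-!
# The pairwise "no common constituent" criterion for the rank of a family of CM types

Companion of `NumberTheory/ComplexMultiplication/CMTypeRankFamilies` (setting: a group `G` acting slot by slot on
`⊔_i E_i` = Deligne's `Hom(∏_i K_i, ℂ)`, the family type `Σ = sigmaType Φ` of CM types `Φ_i ⊆ E_i`, Shimura's
antisymmetric spans `U(Φ_i) = antiSpan G (Φ_i)` and `U(Σ)`, always `U(Σ) ⊆ ⊕_i U(Φ_i)` with `rank = dim U + 1`), of
`CMTypeRankPartialConjugation` (rank additivity `U(Σ) = ⊕_i U(Φ_i)` from a PARTIAL CONJUGATION AT EVERY SLOT) and of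
`CMTypeRankBlockConjugation` (the block form).  Those criteria, and slotwise independence, are instances of one
representation-theoretic mechanism, proved here in its general PAIRWISE form and WITHOUT Maschke's theorem:

> **Theorem** (`map_slotExt_antiSpan_le_of_pairwise`, `finrank_antiSpan_sigmaType_eq_of_pairwise`).  Suppose that for
> every ordered pair of slots `i ≠ j` the `G`-modules `U(Φ_i)` and `U(Φ_j)` have NO COMMON CONSTITUENT, in the following
> concrete sense: every `G`-stable subspace `P ≤ U(Φ_i)` carrying a linear map `T` into `U(Φ_j)` which is
> `G`-equivariant and injective on `P` is zero.  Then `U(Σ) = ⊕_i U(Φ_i)`; hence `rank(Σ) − 1 = Σ_i (rank(Φ_i) − 1)`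
> (`typeRank_sigmaType_add_card_eq_of_pairwise`: on Hodge groups `Hg(∏_i A_i) = ∏_i Hg(A_i)`) and `Σ` is nondegenerate
> iff every `Φ_i` is (`typeRank_sigmaType_eq_iff_forall_of_pairwise`).

PROOF.  `G` acts on `ℚ^{⊔_i E_i}` by permutations, so the dot product is `G`-invariant (`dotProduct_comp_smul`).  Let
`U = {f | every slot restriction f|_{E_i} ∈ U(Φ_i)} ≅ ⊕_i U(Φ_i)` and `M = U(Σ) ≤ U`; every slot restriction maps `M`
ONTO `U(Φ_i)`.  If `M ≠ U`, the `G`-stable subspace `C = U ∩ M^⊥` is non-zero (dimension count with the non-degenerate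
dot product), hence contains a MINIMAL non-zero `G`-stable subspace `P` (finite dimension).  By minimality each slot
restriction is either zero or injective on `P`.  If two restrictions `p_i, p_j` (`i ≠ j`) are injective on `P`, then
`P_i = p_i(P) ≤ U(Φ_i)` is `G`-stable and `T = p_j ∘ (p_i|_P)⁻¹` (extended linearly to `ℚ^{E_i}`) is equivariant and
injective on `P_i` with values in `U(Φ_j)` — a common constituent, excluded.  So a non-zero `c ∈ P` is supported on ONE
slot `i`; as `c|_{E_i} ∈ U(Φ_i) = p_i(M)` there is `m ∈ M` with `m|_{E_i} = c|_{E_i}`, and `0 = ⟨m, c⟩ = ⟨c|_{E_i},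
c|_{E_i}⟩ > 0`, a contradiction.

SUFFICIENT CONDITIONS for a pair `(i, j)` (both orders at once):
* `pairwise_of_partialConj` — a PAIRWISE partial conjugation: some `σ ∈ G` acting as `ρ` on `E_i` and trivially on `E_j`
  (nothing asked on the other slots; weaker than `SlotwiseIndependent`, than the slot-by-slot hypothesis of
  `CMTypeRankPartialConjugation` and than the block hypothesis): `σ` is `−1` on `U(Φ_i)` and `+1` on `U(Φ_j)`;
* `pairwise_of_eigenvector` — `U(Φ_i)` consists of `χ`-EIGENVECTORS (`f ∘ g = χ(g) f`; e.g. a two-element slot, `χ` its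
  sign character) and `U(Φ_j)` contains no non-zero `χ`-eigenvector (e.g. complex conjugation on `E_j` is the square of an
  element of `G`, or `E_j` is another two-element slot with a different sign character).
These cover Gordon's proof of the theorem of Imai and Murty ([Gordon1999HodgeAVSurvey] §3: "there is some `σ ∈ 𝒢` that
acts as `+1` on `X(K^×_{1,1})` and `−1` on the other components … by induction the kernel of `λ` is zero"), Moonen–Zarhin's
`Hg(X₁ × ⋯ × X_n) = ∏ Hg(X_i)` for pairwise non-isogenous CM elliptic curves through Artin independence, AND mixed families
beyond both (e.g. `ℚ(√-1), ℚ(√-2), ℚ(√-6)` with a type of `ℚ(ζ₉)`: no partial conjugation at any slot, yet pairwise no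
common constituent).  Deligne's dictionary `rank = rank Y(MT)` ([Deligne1982HodgeCycles] I Ex. 3.7 (c)) is not used:
everything is finite-dimensional linear algebra over `ℚ` (the dot product as `dotProductBilin`, its orthogonal complements
`LinearMap.BilinForm.orthogonal`, `LinearMap.exists_extend`); theorems only, no definition, no named fact, no `sorry`.

## References

* [Gordon1999HodgeAVSurvey] B. B. Gordon, *A survey of the Hodge conjecture for abelian varieties*, §3 Theorem (Imai,
  Murty) with proof; 7.5–7.7.
* [Deligne1982HodgeCycles] P. Deligne, *Hodge cycles on abelian varieties*, LNM 900 (1982), I Ex. 3.7.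
* [MoonenZarhin1999LowDim] B. Moonen, Yu. Zarhin, *Hodge classes on abelian varieties of low dimension*, Math. Ann. 315
  (1999), Cor. (3.9).
-/

set_option autoImplicit false

noncomputable section

open scoped BigOperators

namespace Literature.NumberTheory.ComplexMultiplication

variable {G : Type*} [Group G] {I : Type*} {E : I → Type*} [∀ i, MulAction G (E i)]

/-! ### The invariant dot product on a permutation module -/

section Invariance

variable {X : Type*} [MulAction G X] [Fintype X]

/-- **The dot product on `ℚ^X` is invariant under the action of `G` by permutations of `X`** (`⟨f ∘ g, f' ∘ g⟩ = ⟨f, f'⟩`):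
the character lattice of a torus split by a Galois extension carries a Galois-invariant positive form. [folklore] -/
private theorem dotProduct_comp_smul (f f' : X → ℚ) (g : G) :
    (fun x => f (g • x)) ⬝ᵥ (fun x => f' (g • x)) = f ⬝ᵥ f' := by
  simp only [dotProduct]
  exact Fintype.sum_equiv (MulAction.toPerm g) _ _ fun x => rfl

/-- The orthogonal complement (for the dot product) of a `G`-stable subspace is `G`-stable. [folklore] -/
private theorem comp_smul_mem_orthogonal {W : Submodule ℚ (X → ℚ)} (hW : ∀ g : G, ∀ f ∈ W, (fun x => f (g • x)) ∈ W)
    {m : X → ℚ} (hm : m ∈ LinearMap.BilinForm.orthogonal (dotProductBilin ℚ ℚ) W) (g : G) :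
    (fun x => m (g • x)) ∈ LinearMap.BilinForm.orthogonal (dotProductBilin ℚ ℚ) W := by
  rw [LinearMap.BilinForm.mem_orthogonal_iff] at hm ⊢
  intro n hn
  have h1 := hm (fun x => n (g⁻¹ • x)) (hW g⁻¹ n hn)
  simp only [dotProductBilin, LinearMap.coe_mk, AddHom.coe_mk] at h1 ⊢
  rw [← dotProduct_comp_smul (fun x => n (g⁻¹ • x)) m g] at h1
  simpa only [inv_smul_smul] using h1

/-- The dot product on `ℚ^X` is reflexive (it is symmetric). [folklore] -/
private theorem isRefl_dotProductBilin : (dotProductBilin ℚ ℚ : LinearMap.BilinForm ℚ (X → ℚ)).IsRefl := by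
  intro x y h
  change x ⬝ᵥ y = 0 at h
  change y ⬝ᵥ x = 0
  rwa [dotProduct_comm]

/-- The dot product on `ℚ^X` is non-degenerate (it is positive definite over the ordered field `ℚ`). [folklore] -/
private theorem nondegenerate_dotProductBilin : (dotProductBilin ℚ ℚ : LinearMap.BilinForm ℚ (X → ℚ)).Nondegenerate := by
  rw [LinearMap.IsRefl.nondegenerate_iff_separatingLeft isRefl_dotProductBilin]
  intro x hx
  have := hx x
  change x ⬝ᵥ x = 0 at this
  exact dotProduct_self_eq_zero.1 this

/-- **A non-zero `G`-stable subspace of `ℚ^X` contains a MINIMAL non-zero `G`-stable subspace** (finite dimension; no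
complete reducibility is used). [folklore] -/
private theorem exists_minimal_stable {C : Submodule ℚ (X → ℚ)} (hC : C ≠ ⊥)
    (hCst : ∀ g : G, ∀ f ∈ C, (fun x => f (g • x)) ∈ C) :
    ∃ P : Submodule ℚ (X → ℚ), P ≤ C ∧ P ≠ ⊥ ∧ (∀ g : G, ∀ f ∈ P, (fun x => f (g • x)) ∈ P) ∧
      ∀ P' : Submodule ℚ (X → ℚ), P' ≤ P → P' ≠ ⊥ → (∀ g : G, ∀ f ∈ P', (fun x => f (g • x)) ∈ P') → P' = P := by
  classical
  have hex : ∃ n, ∃ P : Submodule ℚ (X → ℚ), P ≤ C ∧ P ≠ ⊥ ∧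
      (∀ g : G, ∀ f ∈ P, (fun x => f (g • x)) ∈ P) ∧ Module.finrank ℚ P = n :=
    ⟨_, C, le_rfl, hC, hCst, rfl⟩
  obtain ⟨P, hPC, hP0, hPst, hPn⟩ := Nat.find_spec hex
  refine ⟨P, hPC, hP0, hPst, fun P' hP'P hP'0 hP'st => ?_⟩
  have hmin := Nat.find_min' hex ⟨P', hP'P.trans hPC, hP'0, hP'st, rfl⟩
  exact Submodule.eq_of_le_of_finrank_eq hP'P (le_antisymm (Submodule.finrank_mono hP'P) (hPn ▸ hmin))

end Invariance

/-! ### Slot restrictions -/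

section Slot

/-- Restricting the `±1`-vector of a translate of `Σ` to the slot `i` gives the `±1`-vector of the translate of `Φ_i`.
[cite: Deligne1982HodgeCycles, I Ex. 3.7 (c) (p. 26)] -/
theorem funLeft_mk_antiVec_sigmaType (Φ : ∀ i, Set (E i)) (i : I) (g : G) :
    LinearMap.funLeft ℚ ℚ (Sigma.mk i) (antiVec (sigmaType Φ) g) = antiVec (Φ i) g := by
  funext s
  rw [LinearMap.funLeft_apply, antiVec_sigmaType]

/-- **Each slot restriction maps `U(Σ)` ONTO `U(Φ_i)`** ("from the definition, `Hg(A)` surjects onto each factor").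
[cite: Gordon1999HodgeAVSurvey, §3 Theorem (proof)] -/
theorem map_funLeft_mk_antiSpan_sigmaType (Φ : ∀ i, Set (E i)) (i : I) :
    (antiSpan G (sigmaType Φ)).map (LinearMap.funLeft ℚ ℚ (Sigma.mk i)) = antiSpan G (Φ i) := by
  simp only [antiSpan, Submodule.map_span, ← Set.range_comp, Function.comp_def, funLeft_mk_antiVec_sigmaType]

/-- Slot restriction commutes with the action. [folklore] -/
private theorem funLeft_mk_comp_smul (i : I) (f : (Σ i, E i) → ℚ) (g : G) :
    LinearMap.funLeft ℚ ℚ (Sigma.mk i) (fun x => f (g • x)) = fun s => LinearMap.funLeft ℚ ℚ (Sigma.mk i) f (g • s) :=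
  rfl

variable [DecidableEq I]

/-- The slot restriction of a slot extension: the same slot gives the weight back. [folklore] -/
private theorem funLeft_mk_slotExt_same (i : I) (a : E i → ℚ) : LinearMap.funLeft ℚ ℚ (Sigma.mk i) (slotExt i a) = a := by
  funext s
  rw [LinearMap.funLeft_apply, slotExt_apply_same]

/-- The slot restriction of a slot extension: another slot gives zero. [folklore] -/
private theorem funLeft_mk_slotExt_of_ne {i j : I} (h : j ≠ i) (a : E i → ℚ) :
    LinearMap.funLeft ℚ ℚ (Sigma.mk j) (slotExt i a) = 0 := by
  funext s
  rw [LinearMap.funLeft_apply, slotExt_apply_of_ne h, Pi.zero_apply]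

/-- A weight whose restrictions to all slots but `i` vanish is the slot extension of its restriction to `i`. [folklore] -/
private theorem eq_slotExt_of_forall_funLeft_mk_eq_zero {i : I} {c : (Σ i, E i) → ℚ}
    (hc : ∀ j, j ≠ i → LinearMap.funLeft ℚ ℚ (Sigma.mk j) c = 0) :
    c = slotExt i (LinearMap.funLeft ℚ ℚ (Sigma.mk i) c) := by
  funext x
  obtain ⟨j, s⟩ := x
  by_cases hji : j = i
  · subst hji
    rw [slotExt_apply_same, LinearMap.funLeft_apply]
  · rw [slotExt_apply_of_ne hji]
    exact congrFun (hc j hji) s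

variable [Fintype I] [∀ i, Fintype (E i)]

omit [DecidableEq I] in
/-- The dot product on `ℚ^{⊔_i E_i}` is the sum of the slot dot products. [folklore] -/
private theorem dotProduct_eq_sum_funLeft_mk (f f' : (Σ i, E i) → ℚ) :
    f ⬝ᵥ f' = ∑ i, LinearMap.funLeft ℚ ℚ (Sigma.mk i) f ⬝ᵥ LinearMap.funLeft ℚ ℚ (Sigma.mk i) f' := by
  simp only [dotProduct, LinearMap.funLeft_apply]
  rw [Fintype.sum_sigma]

end Slot

/-! ### The pairwise criterion -/

section Pairwise

variable [Fintype I] [DecidableEq I] [∀ i, Fintype (E i)]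

/-- **Rank additivity from the pairwise absence of common constituents.**  If for all slots `i ≠ j` every `G`-stable
subspace `P ≤ U(Φ_i)` admitting a linear map `T : ℚ^{E_i} → ℚ^{E_j}` which is `G`-equivariant on `P`, maps `P` into
`U(Φ_j)` and is injective on `P` is zero, then `ext_i(U(Φ_i)) ≤ U(Σ)` for every slot `i` — i.e. `U(Σ) = ⊕_i U(Φ_i)`,
`Hg(∏_i A_i) = ∏_i Hg(A_i)`.  (Proof: invariant dot product, `C = U ∩ U(Σ)^⊥`, a minimal stable `P ≤ C`, two injective
slot restrictions would give a common constituent, one gives `⟨c, c⟩ = 0`.)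
[cite: Gordon1999HodgeAVSurvey, §3 Theorem (proof)] -/
theorem map_slotExt_antiSpan_le_of_pairwise {Φ : ∀ i, Set (E i)}
    (hpair : ∀ i j, i ≠ j → ∀ P : Submodule ℚ (E i → ℚ), P ≤ antiSpan G (Φ i) →
      (∀ g : G, ∀ f ∈ P, (fun x => f (g • x)) ∈ P) →
      ∀ T : (E i → ℚ) →ₗ[ℚ] (E j → ℚ),
        (∀ g : G, ∀ f ∈ P, T (fun x => f (g • x)) = fun y => T f (g • y)) →
        (∀ f ∈ P, T f ∈ antiSpan G (Φ j)) → (∀ f ∈ P, T f = 0 → f = 0) → P = ⊥)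
    (i : I) : (antiSpan G (Φ i)).map (slotExt i) ≤ antiSpan G (sigmaType Φ) := by
  classical
  -- notation: slot restrictions `p j`, `M = U(Σ)`, `U = {f | ∀ j, p j f ∈ U(Φ_j)}`
  set p : ∀ j, ((Σ j, E j) → ℚ) →ₗ[ℚ] (E j → ℚ) := fun j => LinearMap.funLeft ℚ ℚ (Sigma.mk j) with hp_def
  have hpg : ∀ (j) (f : (Σ j, E j) → ℚ) (g : G), p j (fun x => f (g • x)) = fun s => p j f (g • s) :=
    fun _ _ _ => rfl
  set M : Submodule ℚ ((Σ j, E j) → ℚ) := antiSpan G (sigmaType Φ) with hM_def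
  set U : Submodule ℚ ((Σ j, E j) → ℚ) := ⨅ j, (antiSpan G (Φ j)).comap (p j) with hU_def
  have hpU : ∀ j, ∀ f ∈ U, p j f ∈ antiSpan G (Φ j) := fun j f hf =>
    Submodule.mem_comap.1 ((Submodule.mem_iInf _).1 hf j)
  have hpM' : ∀ j, ∀ a ∈ antiSpan G (Φ j), ∃ m ∈ M, p j m = a := fun j a ha => by
    rw [← map_funLeft_mk_antiSpan_sigmaType Φ j] at ha
    obtain ⟨m, hm, rfl⟩ := ha
    exact ⟨m, hm, rfl⟩
  have hpM : ∀ j, ∀ f ∈ M, p j f ∈ antiSpan G (Φ j) := fun j f hf => by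
    rw [← map_funLeft_mk_antiSpan_sigmaType Φ j]
    exact ⟨f, hf, rfl⟩
  have hMU : M ≤ U := fun f hf => (Submodule.mem_iInf _).2 fun j => Submodule.mem_comap.2 (hpM j f hf)
  -- stability of `M` and `U`
  have hMst : ∀ g : G, ∀ f ∈ M, (fun x => f (g • x)) ∈ M := fun g f hf => comp_smul_mem_antiSpan hf g
  have hUst : ∀ g : G, ∀ f ∈ U, (fun x => f (g • x)) ∈ U := fun g f hf =>
    (Submodule.mem_iInf _).2 fun j => Submodule.mem_comap.2 (by
      rw [hpg]
      exact comp_smul_mem_antiSpan (hpU j f hf) g)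
  -- suppose the conclusion fails: then `M < U`
  by_contra hnot
  have hlt : M < U := by
    refine lt_of_le_of_ne hMU fun hMU' => hnot ?_
    rintro _ ⟨a, ha, rfl⟩
    rw [hMU']
    refine (Submodule.mem_iInf _).2 fun j => Submodule.mem_comap.2 ?_
    by_cases hji : j = i
    · subst hji
      change LinearMap.funLeft ℚ ℚ (Sigma.mk j) (slotExt j a) ∈ _
      rw [funLeft_mk_slotExt_same]
      exact ha
    · change LinearMap.funLeft ℚ ℚ (Sigma.mk j) (slotExt i a) ∈ _
      rw [funLeft_mk_slotExt_of_ne hji]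
      exact Submodule.zero_mem _
  -- the stable subspace `C = U ⊓ M^⊥` is non-zero
  set C : Submodule ℚ ((Σ j, E j) → ℚ) := U ⊓ LinearMap.BilinForm.orthogonal (dotProductBilin ℚ ℚ) M with hC_def
  have hCst : ∀ g : G, ∀ f ∈ C, (fun x => f (g • x)) ∈ C := fun g f hf =>
    ⟨hUst g f hf.1, comp_smul_mem_orthogonal hMst hf.2 g⟩
  have hC0 : C ≠ ⊥ := by
    intro hC0
    have h1 := Submodule.finrank_sup_add_finrank_inf_eq U (LinearMap.BilinForm.orthogonal (dotProductBilin ℚ ℚ) M)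
    have h2 := LinearMap.BilinForm.finrank_orthogonal
      (nondegenerate_dotProductBilin (X := Σ j, E j)) M
    have h3 := Submodule.finrank_lt_finrank_of_lt hlt
    have h4 := Submodule.finrank_le (U ⊔ LinearMap.BilinForm.orthogonal (dotProductBilin ℚ ℚ) M)
    have h5 := Submodule.finrank_le M
    rw [← hC_def, hC0, finrank_bot] at h1
    omega
  -- a minimal non-zero stable subspace `P ≤ C`
  obtain ⟨P, hPC, hP0, hPst, hPmin⟩ := exists_minimal_stable hC0 hCst
  have hPU : P ≤ U := hPC.trans inf_le_left
  -- dichotomy: each slot restriction is zero or injective on `P`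
  have hdich : ∀ j, (∀ f ∈ P, p j f = 0) ∨ ∀ f ∈ P, p j f = 0 → f = 0 := by
    intro j
    by_cases hK : P ⊓ LinearMap.ker (p j) = ⊥
    · refine Or.inr fun f hf hf0 => ?_
      have : f ∈ P ⊓ LinearMap.ker (p j) := ⟨hf, LinearMap.mem_ker.2 hf0⟩
      rw [hK] at this
      exact (Submodule.mem_bot ℚ).1 this
    · refine Or.inl fun f hf => ?_
      have hKst : ∀ g : G, ∀ f ∈ P ⊓ LinearMap.ker (p j), (fun x => f (g • x)) ∈ P ⊓ LinearMap.ker (p j) :=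
        fun g f hf => Submodule.mem_inf.2 ⟨hPst g f (Submodule.mem_inf.1 hf).1, by
          have h0 : p j f = 0 := LinearMap.mem_ker.1 (Submodule.mem_inf.1 hf).2
          rw [LinearMap.mem_ker, hpg, h0]
          rfl⟩
      have hKP := hPmin _ inf_le_left hK hKst
      have : f ∈ P ⊓ LinearMap.ker (p j) := by rw [hKP]; exact hf
      exact LinearMap.mem_ker.1 this.2
  obtain ⟨c, hcP, hc0⟩ := (Submodule.ne_bot_iff P).1 hP0
  by_cases htwo : ∃ j j', j ≠ j' ∧ (¬∀ f ∈ P, p j f = 0) ∧ ¬∀ f ∈ P, p j' f = 0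
  · -- two injective slot restrictions: a common constituent of `U(Φ_j)` and `U(Φ_j')`
    obtain ⟨j, j', hjj', hj, hj'⟩ := htwo
    have hinj : ∀ f ∈ P, p j f = 0 → f = 0 := (hdich j).resolve_left hj
    have hinj' : ∀ f ∈ P, p j' f = 0 → f = 0 := (hdich j').resolve_left hj'
    -- `e : P ≃ p_j(P)`, `T = p_j' ∘ e⁻¹` extended to `ℚ^{E_j}`
    have hinjr : Function.Injective ((p j).domRestrict P) := by
      intro f f' hff'
      apply Subtype.ext
      have h0 : p j ((f : (Σ j, E j) → ℚ) - f') = 0 := by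
        rw [map_sub, sub_eq_zero]
        exact hff'
      exact sub_eq_zero.1 (hinj _ (P.sub_mem f.2 f'.2) h0)
    obtain ⟨T, hT⟩ := LinearMap.exists_extend
      (((p j').domRestrict P) ∘ₗ (LinearEquiv.ofInjective ((p j).domRestrict P) hinjr).symm.toLinearMap)
    have hTc : ∀ f : P, T (p j f) = p j' f := fun f => by
      have h1 := LinearMap.congr_fun hT (LinearEquiv.ofInjective ((p j).domRestrict P) hinjr f)
      simpa only [LinearMap.comp_apply, Submodule.coe_subtype, LinearEquiv.coe_toLinearMap,
        LinearEquiv.symm_apply_apply, LinearMap.domRestrict_apply, LinearEquiv.ofInjective_apply] using h1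
    have hmemPj : ∀ f, f ∈ LinearMap.range ((p j).domRestrict P) ↔ ∃ c' ∈ P, p j c' = f := fun f => by
      rw [LinearMap.mem_range]
      constructor
      · rintro ⟨c', rfl⟩
        exact ⟨c', c'.2, rfl⟩
      · rintro ⟨c', hc', rfl⟩
        exact ⟨⟨c', hc'⟩, rfl⟩
    have hPj0 : LinearMap.range ((p j).domRestrict P) = ⊥ := by
      refine hpair j j' hjj' _ ?_ ?_ T ?_ ?_ ?_
      · intro f hf
        obtain ⟨c', hc', rfl⟩ := (hmemPj f).1 hf
        exact hpU j c' (hPU hc')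
      · intro g f hf
        obtain ⟨c', hc', rfl⟩ := (hmemPj f).1 hf
        refine (hmemPj _).2 ⟨fun x => c' (g • x), hPst g c' hc', ?_⟩
        rw [hpg]
      · intro g f hf
        obtain ⟨c', hc', rfl⟩ := (hmemPj f).1 hf
        have h1 := hTc ⟨c', hc'⟩
        have h2 := hTc ⟨fun x => c' (g • x), hPst g c' hc'⟩
        rw [hpg] at h2
        rw [h2, h1, hpg]
      · intro f hf
        obtain ⟨c', hc', rfl⟩ := (hmemPj f).1 hf
        have h1 := hTc ⟨c', hc'⟩
        rw [h1]
        exact hpU j' c' (hPU hc')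
      · intro f hf hf0
        obtain ⟨c', hc', rfl⟩ := (hmemPj f).1 hf
        have h1 := hTc ⟨c', hc'⟩
        rw [h1] at hf0
        rw [hinj' c' hc' hf0, map_zero]
    have hcPj : p j c ∈ LinearMap.range ((p j).domRestrict P) := (hmemPj _).2 ⟨c, hcP, rfl⟩
    rw [hPj0, Submodule.mem_bot] at hcPj
    exact hc0 (hinj c hcP hcPj)
  · -- at most one non-zero slot restriction on `P`: `c` is supported on one slot `j`
    have hcj : ∃ j, p j c ≠ 0 := by
      by_contra hall
      apply hc0
      funext x
      obtain ⟨j, s⟩ := x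
      have h0 : p j c = 0 := not_not.1 fun hne => hall ⟨j, hne⟩
      exact congrFun h0 s
    obtain ⟨j, hj⟩ := hcj
    have hvan : ∀ j', j' ≠ j → ∀ f ∈ P, p j' f = 0 := fun j' hj'j => by
      by_contra hne
      exact htwo ⟨j', j, hj'j, hne, fun hall => hj (hall c hcP)⟩
    obtain ⟨m, hmM, hm⟩ := hpM' j (p j c) (hpU j c (hPU hcP))
    -- `⟨m, c⟩ = 0` since `c ∈ M^⊥`
    have horth : m ⬝ᵥ c = 0 := by
      have h2 := LinearMap.BilinForm.mem_orthogonal_iff.1 (hPC hcP).2 m hmM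
      simpa only [dotProductBilin, LinearMap.coe_mk, AddHom.coe_mk] using h2
    -- `⟨m, c⟩ = ⟨p_j m, p_j c⟩ = ⟨p_j c, p_j c⟩`
    have hsum : m ⬝ᵥ c = p j c ⬝ᵥ p j c := by
      rw [dotProduct_eq_sum_funLeft_mk, Finset.sum_eq_single j]
      · change p j m ⬝ᵥ p j c = _
        rw [hm]
      · intro j' _ hj'j
        change p j' m ⬝ᵥ p j' c = 0
        rw [hvan j' hj'j c hcP, dotProduct_zero]
      · intro h
        exact absurd (Finset.mem_univ j) h
    rw [hsum] at horth
    exact hj (dotProduct_self_eq_zero.1 horth)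

/-- **`⊕_i U(Φ_i) ≤ U(Σ)` under the pairwise criterion** (the assembled weights of the members lie in `U(Σ)`).
[cite: Gordon1999HodgeAVSurvey, §3 Theorem (1)] -/
theorem range_le_antiSpan_sigmaType_of_pairwise {Φ : ∀ i, Set (E i)}
    (hpair : ∀ i j, i ≠ j → ∀ P : Submodule ℚ (E i → ℚ), P ≤ antiSpan G (Φ i) →
      (∀ g : G, ∀ f ∈ P, (fun x => f (g • x)) ∈ P) →
      ∀ T : (E i → ℚ) →ₗ[ℚ] (E j → ℚ),
        (∀ g : G, ∀ f ∈ P, T (fun x => f (g • x)) = fun y => T f (g • y)) →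
        (∀ f ∈ P, T f ∈ antiSpan G (Φ j)) → (∀ f ∈ P, T f = 0 → f = 0) → P = ⊥) :
    LinearMap.range (sigmaLift ∘ₗ LinearMap.pi fun i => (antiSpan G (Φ i)).subtype ∘ₗ LinearMap.proj i) ≤
      antiSpan G (sigmaType Φ) := by
  rintro _ ⟨a, rfl⟩
  change sigmaLift (fun i => (a i : E i → ℚ)) ∈ _
  rw [sigmaLift_eq_sum_slotExt]
  exact Submodule.sum_mem _ fun i _ => map_slotExt_antiSpan_le_of_pairwise hpair i ⟨(a i : E i → ℚ), (a i).2, rfl⟩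

/-- **`dim U(Σ) = Σ_i dim U(Φ_i)` under the pairwise criterion** (`rank Hg(∏_i A_i) = Σ_i rank Hg(A_i)`).
[cite: Gordon1999HodgeAVSurvey, §3 Theorem (1)] -/
theorem finrank_antiSpan_sigmaType_eq_of_pairwise {Φ : ∀ i, Set (E i)}
    (hpair : ∀ i j, i ≠ j → ∀ P : Submodule ℚ (E i → ℚ), P ≤ antiSpan G (Φ i) →
      (∀ g : G, ∀ f ∈ P, (fun x => f (g • x)) ∈ P) →
      ∀ T : (E i → ℚ) →ₗ[ℚ] (E j → ℚ),
        (∀ g : G, ∀ f ∈ P, T (fun x => f (g • x)) = fun y => T f (g • y)) →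
        (∀ f ∈ P, T f ∈ antiSpan G (Φ j)) → (∀ f ∈ P, T f = 0 → f = 0) → P = ⊥) :
    Module.finrank ℚ (antiSpan G (sigmaType Φ)) = ∑ i, Module.finrank ℚ (antiSpan G (Φ i)) := by
  classical
  refine le_antisymm (finrank_antiSpan_sigmaType_le Φ) ?_
  have hinj : Function.Injective
      (sigmaLift ∘ₗ LinearMap.pi fun i => (antiSpan G (Φ i)).subtype ∘ₗ LinearMap.proj i) := by
    intro a b hab
    funext i
    apply Subtype.ext
    funext s
    exact congrFun hab ⟨i, s⟩
  calc ∑ i, Module.finrank ℚ (antiSpan G (Φ i))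
      = Module.finrank ℚ (∀ i, antiSpan G (Φ i)) := (Module.finrank_pi_fintype ℚ).symm
    _ = Module.finrank ℚ (LinearMap.range
          (sigmaLift ∘ₗ LinearMap.pi fun i => (antiSpan G (Φ i)).subtype ∘ₗ LinearMap.proj i)) :=
        (LinearMap.finrank_range_of_inj hinj).symm
    _ ≤ Module.finrank ℚ (antiSpan G (sigmaType Φ)) :=
        Submodule.finrank_mono (range_le_antiSpan_sigmaType_of_pairwise hpair)

variable [Nonempty I] [∀ i, Nonempty (E i)]

/-- **`rank(Σ) + |I| = Σ_i rank(Φ_i) + 1`, i.e. `rank(Σ) − 1 = Σ_i (rank(Φ_i) − 1)`, under the pairwise criterion**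
(`Hg(∏_i A_i) = ∏_i Hg(A_i)`). [cite: Gordon1999HodgeAVSurvey, §3 Theorem (1)] -/
theorem typeRank_sigmaType_add_card_eq_of_pairwise {ρ : G} {Φ : ∀ i, Set (E i)} (h : ∀ i, IsCMTypeWith ρ (Φ i))
    (hpair : ∀ i j, i ≠ j → ∀ P : Submodule ℚ (E i → ℚ), P ≤ antiSpan G (Φ i) →
      (∀ g : G, ∀ f ∈ P, (fun x => f (g • x)) ∈ P) →
      ∀ T : (E i → ℚ) →ₗ[ℚ] (E j → ℚ),
        (∀ g : G, ∀ f ∈ P, T (fun x => f (g • x)) = fun y => T f (g • y)) →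
        (∀ f ∈ P, T f ∈ antiSpan G (Φ j)) → (∀ f ∈ P, T f = 0 → f = 0) → P = ⊥) :
    typeRank G (sigmaType Φ) + Fintype.card I = (∑ i, typeRank G (Φ i)) + 1 := by
  obtain ⟨i₀⟩ := ‹Nonempty I›
  haveI : Nonempty (Σ i, E i) := ⟨⟨i₀, Classical.arbitrary (E i₀)⟩⟩
  rw [(IsCMTypeWith.sigmaType h).typeRank_eq_finrank_antiSpan_add_one,
    Finset.sum_congr rfl fun i _ => (h i).typeRank_eq_finrank_antiSpan_add_one, Finset.sum_add_distrib,
    Finset.sum_const, Finset.card_univ, smul_eq_mul, mul_one, finrank_antiSpan_sigmaType_eq_of_pairwise hpair]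
  omega

/-- **Under the pairwise criterion, `Σ` is nondegenerate iff every member is** (stable nondegeneracy of the product
`∏_i A_{Φ_i}` ⟺ nondegeneracy of every factor; Gordon 7.5 (3)). [cite: Gordon1999HodgeAVSurvey, §3 Theorem and 7.5] -/
theorem typeRank_sigmaType_eq_iff_forall_of_pairwise {ρ : G} {Φ : ∀ i, Set (E i)} (h : ∀ i, IsCMTypeWith ρ (Φ i))
    (hpair : ∀ i j, i ≠ j → ∀ P : Submodule ℚ (E i → ℚ), P ≤ antiSpan G (Φ i) →
      (∀ g : G, ∀ f ∈ P, (fun x => f (g • x)) ∈ P) →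
      ∀ T : (E i → ℚ) →ₗ[ℚ] (E j → ℚ),
        (∀ g : G, ∀ f ∈ P, T (fun x => f (g • x)) = fun y => T f (g • y)) →
        (∀ f ∈ P, T f ∈ antiSpan G (Φ j)) → (∀ f ∈ P, T f = 0 → f = 0) → P = ⊥) :
    typeRank G (sigmaType Φ) = Fintype.card (Σ i, E i) / 2 + 1 ↔
      ∀ i, typeRank G (Φ i) = Fintype.card (E i) / 2 + 1 := by
  have hsum := typeRank_sigmaType_add_card_eq_of_pairwise h hpair
  have hle : ∀ i, typeRank G (Φ i) ≤ Fintype.card (E i) / 2 + 1 := fun i => (h i).typeRank_le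
  have htot : ∑ j, (Fintype.card (E j) / 2 + 1) = (∑ j, Fintype.card (E j) / 2) + Fintype.card I := by
    rw [Finset.sum_add_distrib, Finset.sum_const, Finset.card_univ, smul_eq_mul, mul_one]
  rw [card_sigma_div_two h]
  constructor
  · intro hS i
    by_contra hne
    have hlt : typeRank G (Φ i) < Fintype.card (E i) / 2 + 1 := lt_of_le_of_ne (hle i) hne
    have hsum_lt : ∑ j, typeRank G (Φ j) < ∑ j, (Fintype.card (E j) / 2 + 1) :=
      Finset.sum_lt_sum (fun j _ => hle j) ⟨i, Finset.mem_univ i, hlt⟩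
    rw [htot] at hsum_lt
    omega
  · intro hall
    have hsum_eq : ∑ j, typeRank G (Φ j) = ∑ j, (Fintype.card (E j) / 2 + 1) := Finset.sum_congr rfl fun j _ => hall j
    rw [htot] at hsum_eq
    omega

end Pairwise

/-! ### Sufficient conditions for a pair of slots -/

section Sufficient

/-- Elements of `U(Φ)` are `ρ`-anti-invariant: `f(ρx) = −f(x)` (`U ≤ Anti`). [cite: Shimura1998, §32.10 (proof)] -/
theorem apply_rho_smul_of_mem_antiSpan {X : Type*} [MulAction G X] {ρ : G} {Ψ : Set X} (h : IsCMTypeWith ρ Ψ)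
    {f : X → ℚ} (hf : f ∈ antiSpan G Ψ) (x : X) : f (ρ • x) = -f x := by
  induction hf using Submodule.span_induction generalizing x with
  | mem u hu =>
    obtain ⟨g, rfl⟩ := hu
    simp only [antiVec, h.translateInd_rho_smul]
    ring
  | zero => simp
  | add u v _ _ hu hv => rw [Pi.add_apply, Pi.add_apply, hu, hv]; ring
  | smul c u _ hu => rw [Pi.smul_apply, Pi.smul_apply, hu, smul_eq_mul, smul_eq_mul]; ring

/-- **A pairwise partial conjugation excludes common constituents, in both orders.**  If some `σ ∈ G` acts as `ρ` on
`E_i` and trivially on `E_j` (nothing is asked on the other slots), then `σ` is `−1` on every `P ≤ U(Φ_i)` and `+1` on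
`U(Φ_j)`, so no non-zero equivariant `T` maps one injectively into the other ("acts as `+1` on `X(K^×_{1,1})` and `−1` on
the other components"). [cite: Gordon1999HodgeAVSurvey, §3 Theorem (proof)] -/
theorem pairwise_of_partialConj {ρ : G} {Φ : ∀ i, Set (E i)} (h : ∀ i, IsCMTypeWith ρ (Φ i)) {i j : I} {σ : G}
    (hσi : ∀ s : E i, σ • s = ρ • s) (hσj : ∀ s : E j, σ • s = s) :
    (∀ P : Submodule ℚ (E i → ℚ), P ≤ antiSpan G (Φ i) →
      (∀ g : G, ∀ f ∈ P, (fun x => f (g • x)) ∈ P) →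
      ∀ T : (E i → ℚ) →ₗ[ℚ] (E j → ℚ),
        (∀ g : G, ∀ f ∈ P, T (fun x => f (g • x)) = fun y => T f (g • y)) →
        (∀ f ∈ P, T f ∈ antiSpan G (Φ j)) → (∀ f ∈ P, T f = 0 → f = 0) → P = ⊥) ∧
    (∀ P : Submodule ℚ (E j → ℚ), P ≤ antiSpan G (Φ j) →
      (∀ g : G, ∀ f ∈ P, (fun x => f (g • x)) ∈ P) →
      ∀ T : (E j → ℚ) →ₗ[ℚ] (E i → ℚ),
        (∀ g : G, ∀ f ∈ P, T (fun x => f (g • x)) = fun y => T f (g • y)) →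
        (∀ f ∈ P, T f ∈ antiSpan G (Φ i)) → (∀ f ∈ P, T f = 0 → f = 0) → P = ⊥) := by
  constructor
  · intro P hPU _ T hTeq hTU hTinj
    refine (Submodule.eq_bot_iff P).2 fun f hf => hTinj f hf ?_
    -- `T f = T(f ∘ σ)` read on `E_j` equals `T f`; but `f ∘ σ = −f` on `E_i`
    have h1 : (fun x => f (σ • x)) = -f := by
      funext x
      rw [hσi x, apply_rho_smul_of_mem_antiSpan (h i) (hPU hf) x, Pi.neg_apply]
    have h2 : (fun y => T f (σ • y)) = T f := by
      funext y
      rw [hσj y]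
    have h3 := hTeq σ f hf
    rw [h1, h2, map_neg] at h3
    -- `-T f = T f`
    have h4 : (2 : ℚ) • T f = 0 := by rw [two_smul]; nth_rewrite 1 [← h3]; rw [neg_add_cancel]
    exact (smul_eq_zero.1 h4).resolve_left two_ne_zero
  · intro P hPU _ T hTeq hTU hTinj
    refine (Submodule.eq_bot_iff P).2 fun f hf => hTinj f hf ?_
    have h1 : (fun x => f (σ • x)) = f := by
      funext x
      rw [hσj x]
    have h2 : (fun y => T f (σ • y)) = -T f := by
      funext y
      rw [hσi y, apply_rho_smul_of_mem_antiSpan (h i) (hTU f hf) y, Pi.neg_apply]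
    have h3 := hTeq σ f hf
    rw [h1, h2] at h3
    have h4 : (2 : ℚ) • T f = 0 := by rw [two_smul]; nth_rewrite 2 [h3]; rw [add_neg_cancel]
    exact (smul_eq_zero.1 h4).resolve_left two_ne_zero

/-- **Eigenvector exclusion, in both orders.**  If every element of `U(Φ_i)` is a `χ`-eigenvector for the action
(`f ∘ (g • ·) = χ(g) f`; e.g. a two-element slot, `χ` its sign character) and `U(Φ_j)` contains no non-zero
`χ`-eigenvector, then `U(Φ_i)` and `U(Φ_j)` have no common constituent. [cite: Gordon1999HodgeAVSurvey, §3 Theorem (proof)] -/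
theorem pairwise_of_eigenvector {Φ : ∀ i, Set (E i)} {i j : I} (χ : G → ℚ)
    (hUi : ∀ f ∈ antiSpan G (Φ i), ∀ g : G, (fun x => f (g • x)) = χ g • f)
    (hUj : ∀ f ∈ antiSpan G (Φ j), (∀ g : G, (fun x => f (g • x)) = χ g • f) → f = 0) :
    (∀ P : Submodule ℚ (E i → ℚ), P ≤ antiSpan G (Φ i) →
      (∀ g : G, ∀ f ∈ P, (fun x => f (g • x)) ∈ P) →
      ∀ T : (E i → ℚ) →ₗ[ℚ] (E j → ℚ),
        (∀ g : G, ∀ f ∈ P, T (fun x => f (g • x)) = fun y => T f (g • y)) →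
        (∀ f ∈ P, T f ∈ antiSpan G (Φ j)) → (∀ f ∈ P, T f = 0 → f = 0) → P = ⊥) ∧
    (∀ P : Submodule ℚ (E j → ℚ), P ≤ antiSpan G (Φ j) →
      (∀ g : G, ∀ f ∈ P, (fun x => f (g • x)) ∈ P) →
      ∀ T : (E j → ℚ) →ₗ[ℚ] (E i → ℚ),
        (∀ g : G, ∀ f ∈ P, T (fun x => f (g • x)) = fun y => T f (g • y)) →
        (∀ f ∈ P, T f ∈ antiSpan G (Φ i)) → (∀ f ∈ P, T f = 0 → f = 0) → P = ⊥) := by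
  constructor
  · intro P hPU _ T hTeq hTU hTinj
    refine (Submodule.eq_bot_iff P).2 fun f hf => hTinj f hf (hUj (T f) (hTU f hf) fun g => ?_)
    rw [← hTeq g f hf, hUi f (hPU hf) g, map_smul]
  · intro P hPU hPst T hTeq hTU hTinj
    refine (Submodule.eq_bot_iff P).2 fun f hf => hUj f (hPU hf) fun g => ?_
    -- `T (f ∘ g − χ g • f) = 0`, and `T` is injective on `P`
    have h1 : T ((fun x => f (g • x)) - χ g • f) = 0 := by
      rw [map_sub, map_smul, hTeq g f hf, ← hUi (T f) (hTU f hf) g, sub_self]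
    have h2 := hTinj _ (Submodule.sub_mem _ (hPst g f hf) (Submodule.smul_mem _ _ hf)) h1
    exact sub_eq_zero.1 h2

end Sufficient

end Literature.NumberTheory.ComplexMultiplication

end
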